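import Summits.BirchSwinnertonDyer.BirchSwinnertonDyer.Theorems.KimAtThreeKolyvaginCertificateDictionary
import Summits.BirchSwinnertonDyer.BirchSwinnertonDyer.Theorems.KimAtThreeKolyvaginDeepUpperRungAdditive
import HarnessLib

/-!
# Route `KimAtThreeKolyvagin` (rung W2), crux `DeepUpperAtThree`: the `Ш[3]`-TRIVIAL rungs
# (the crux holds outright wherever `3 ∤ #Ш(E)`; hence on every slice where a printed upper bound is sharp)

Cell `bsd-addord`, seat `bsd-addord-w2-c3` (D-0074 row B6), item `stmt-BirchSwinnertonDyer-19076`.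
The crux `DeepUpperAtThree` asks, on every tower row of analytic rank `0`, for
`ord₃ #Ш(E/ℚ)(3) + ∂^{(∞)}_{deep}(δ̃) ≤ ∂⁽⁰⁾(δ̃)`. Since `∂^{(∞)}_{deep}(δ̃) ≤ ∂⁽⁰⁾(δ̃)` is a tree lemma
(`kuriharaPartialDeepInfty_le_kuriharaPartial_zero`: the level `n = 1` lies in every `𝒩_k`), the
conclusion of the crux holds OUTRIGHT on every row with `Ш(E)[3] = 0`
(`deepUpper_conclusion_of_padicValNat_sha_eq_zero`, general `p`, no Euler system): the whole content
of crux 19076 sits on the rows with `Ш(E)[3] ≠ 0`, where it says that SOME Kurihara number at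
arbitrarily deep cyclic levels is strictly less `3`-divisible than `δ̃₁` by at least `ord₃ #Ш(3)`
(certificate SUPPLY, `deepUpper_conclusion_iff_certificateSupply`). Consequently every PRINTED upper
bound `ord₃ #Ш(3) + e ≤ ∂⁽⁰⁾(δ̃)` yields the crux on the slice `∂⁽⁰⁾(δ̃) ≤ e` where it is sharp
(`deepUpper_conclusion_of_add_le_of_le`):

* `deepUpper_conclusion_potGood_of_kuriharaPartial_zero_le_tamagawa_of_kato2004TamagawaExact` — Kato
  Thm. 14.5 (3) Tamagawa-exact (PUB, `ord₃ #Ш(3) + v₃(∏ c_ℓ) ≤ ∂⁽⁰⁾`): the crux on tower ∧ additive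
  potentially good ∧ `hper` rows with `ord₃ δ̃₁ ≤ v₃(∏ c_ℓ)`;
* `sha_add_localTamagawa_le_kuriharaPartial_zero_of_kato2004ManinFree` — the Manin-free `c₃`-sharpened
  reading (PUB) in the crux's currency WITH its local term kept: `ord₃ #Ш(3) + v₃(c₃) ≤ ∂⁽⁰⁾(δ̃)` (the
  landed `deepUpperAtThree_truncation_potGood_of_kato2004ManinFree` dropped `v₃(c₃)`), whence
  `deepUpper_conclusion_potGood_of_kuriharaPartial_zero_le_localTamagawa_of_kato2004ManinFree` — the crux
  on the slice `ord₃ δ̃₁ ≤ v₃(c₃)`: this is the seat fragment's «next slice `v₃(c₃) = 1`, Kodaira IV /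
  IV*» in the only form in which it is a theorem from print (`ord₃ δ̃₁ ≤ 1` there), no Tamagawa-away-
  from-`3`, Manin or parity binder;
* `deepUpper_conclusion_additive_unitLevelOne_of_kimNakamura2020` — Kim–Nakamura 2020 Thm. 1.7 (PUB)
  on the WHOLE additive locus incl. the potentially MULTIPLICATIVE rows: the crux on the unit-`δ̃₁`
  slice there (the first piece of the birth stub `stub_upper_potMult`; the landed unit-`δ̃₁` rung
  `deepUpperAtThree_potGood_of_unitLevelOne_of_kato2004ManinFree` was potentially-good only).
* `padicValNat_sha_eq_zero_of_deepUpper_conclusion_of_deepInfty_eq` — conversely the crux PREDICTS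
  `Ш(E)[3] = 0` on every row whose deep limit equals `∂⁽⁰⁾` (no deep certificate below `δ̃₁`).

Every printed input is a hypothesis BY NAME (`def … : Prop` facts of the tree); nothing is asserted;
the crux stays open. [cite: Kato2004Asterisque, Thm. 14.5 (3) (p. 236), Prop. 14.16 (2) (p. 244), Prop. 14.21 and 14.22 (pp. 248–249), §14.8 (p. 238)]
[cite: KimNakamura2020, Thm. 1.7 and Rem. 1.8 (1) (arXiv p. 4)] [cite: Kim2022StructureSelmer, §1.5.1 (PDF p. 7)]
[cite: MazurRubin2004, Def. 4.5.7, Def. 5.2.11] [cite: Kim2025RefinedTNC, Thm 1.1]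
-/

set_option autoImplicit false
-- the Theorems namespace of a single-conjunct summit repeats the summit name by design (D-0017)
set_option linter.dupNamespace false

noncomputable section

open scoped MatrixGroups ModularForm Classical

open CongruenceSubgroup WeierstrassCurve Literature.NumberTheory.EllipticCurves
  Literature.NumberTheory.EllipticCurves.ModularForms

namespace Summit.BirchSwinnertonDyer.BirchSwinnertonDyer.Theorems.KimAtThreeDeepUpperShaTrivialRungs

open Summit.BirchSwinnertonDyer.Rank1Residual.Additive
open Summit.BirchSwinnertonDyer.BirchSwinnertonDyer.Theses.KimAtThreeKolyvagin
open Summit.BirchSwinnertonDyer.BirchSwinnertonDyer.Theorems.KimAtThreeKolyvaginDeepUpperRung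
open Summit.BirchSwinnertonDyer.BirchSwinnertonDyer.Theorems.KimAtThreeKolyvaginDeepUpperRungAdditive
open Summit.BirchSwinnertonDyer.BirchSwinnertonDyer.Theorems.KimAtThreeKolyvaginUnitLevelOneRungs
open Summit.BirchSwinnertonDyer.BirchSwinnertonDyer.Theorems.KimAtThreeKolyvaginCertificateDictionary

/-! ### §1 The `Ш[p]`-trivial principle (general `p`, unconditional) -/

section Principle

variable (W : WeierstrassCurve ℚ) [W.IsGloballyMinimal] (p : ℕ) {N : ℕ} (f : CuspForm (Gamma0 N) 2)

/-- **Crux 19076's conclusion holds OUTRIGHT when `p ∤ #Ш(E)`.** In analytic rank `0`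
(`ord(δ̃) = 0`) the deep limit is a natural number `d` with `d ≤ ∂⁽⁰⁾(δ̃)`
(`kuriharaPartialDeepInfty_le_kuriharaPartial_zero`); with `ord_p #Ш(E)(p) = 0` that IS the
conclusion `∃ d, ∂^{(∞)}_{deep} = d ∧ ord_p #Ш(p) + d ≤ ∂⁽⁰⁾`. No Euler system, no fact.
[cite: MazurRubin2004, Def. 4.5.7, Def. 5.2.11] [cite: Kim2022StructureSelmer, §1.4.4 and §1.5.1 (PDF p. 7)] -/
theorem deepUpper_conclusion_of_padicValNat_sha_eq_zero (hord : kuriharaVanishingOrder W p f = 0)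
    (hsha : padicValNat p (Nat.card (AddCommGroup.primaryComponent W.sha p)) = 0) :
    ∃ d : ℕ, kuriharaPartialDeepInfty W p f = d ∧
      ((padicValNat p (Nat.card (AddCommGroup.primaryComponent W.sha p)) + d : ℕ) : ℕ∞) ≤
        kuriharaPartial W p f 0 := by
  obtain ⟨d, hd⟩ :=
    exists_kuriharaPartialDeepInfty_eq_natCast_of_kuriharaVanishingOrder_eq_zero W p f hord
  refine ⟨d, hd, ?_⟩
  rw [hsha, zero_add, ← hd]
  exact kuriharaPartialDeepInfty_le_kuriharaPartial_zero W p f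

/-- **A sharp truncation gives the crux.** If some upper bound `ord_p #Ш(p) + e ≤ ∂⁽⁰⁾(δ̃)` holds at
the row (any `e : ℕ` — a Tamagawa exponent, a local term, `0`) and the row lies on the slice
`∂⁽⁰⁾(δ̃) ≤ e`, then `ord_p #Ш(p) = 0` and crux 19076's conclusion holds at the row.
[cite: Kim2022StructureSelmer, §1.5.1 (PDF p. 7)] -/
theorem deepUpper_conclusion_of_add_le_of_le (hord : kuriharaVanishingOrder W p f = 0) {e : ℕ}
    (hK : ((padicValNat p (Nat.card (AddCommGroup.primaryComponent W.sha p)) + e : ℕ) : ℕ∞) ≤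
      kuriharaPartial W p f 0)
    (hslice : kuriharaPartial W p f 0 ≤ (e : ℕ∞)) :
    ∃ d : ℕ, kuriharaPartialDeepInfty W p f = d ∧
      ((padicValNat p (Nat.card (AddCommGroup.primaryComponent W.sha p)) + d : ℕ) : ℕ∞) ≤
        kuriharaPartial W p f 0 := by
  refine deepUpper_conclusion_of_padicValNat_sha_eq_zero W p f hord ?_
  have h : padicValNat p (Nat.card (AddCommGroup.primaryComponent W.sha p)) + e ≤ e := by
    exact_mod_cast hK.trans hslice
  omega

/-- **Conversely the crux PREDICTS `Ш(E)[p] = 0` where no deep certificate lies below `δ̃₁`**: if the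
conclusion of crux 19076 holds at a row whose deep limit equals `∂⁽⁰⁾(δ̃)` (`∂^{(∞)}_{deep} = ∂⁽⁰⁾ = a`:
at arbitrarily deep levels every Kurihara number of bounded `ν` is as `p`-divisible as `δ̃₁`), then
`ord_p #Ш(E)(p) = 0`. [cite: Kim2022StructureSelmer, Thm. 1.9 (6), §1.5.1 (PDF p. 7)] [cite: Kim2025RefinedTNC, Thm 1.1] -/
theorem padicValNat_sha_eq_zero_of_deepUpper_conclusion_of_deepInfty_eq {a : ℕ}
    (ha : kuriharaPartial W p f 0 = a) (hdeep : kuriharaPartialDeepInfty W p f = a)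
    (hU : ∃ d : ℕ, kuriharaPartialDeepInfty W p f = d ∧
      ((padicValNat p (Nat.card (AddCommGroup.primaryComponent W.sha p)) + d : ℕ) : ℕ∞) ≤
        kuriharaPartial W p f 0) :
    padicValNat p (Nat.card (AddCommGroup.primaryComponent W.sha p)) = 0 := by
  obtain ⟨d, hd, hle⟩ := hU
  have hda : d = a := by
    have : ((d : ℕ) : ℕ∞) = (a : ℕ∞) := by rw [← hd, hdeep]
    exact_mod_cast this
  subst hda
  rw [ha] at hle
  have : padicValNat p (Nat.card (AddCommGroup.primaryComponent W.sha p)) + d ≤ d := by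
    exact_mod_cast hle
  omega

end Principle

/-! ### §2 The Kato-sharp slices at `p = 3` (potentially good rows) -/

/-- Under the tower (use `n = 1`), `E[3]` is irreducible. [folklore] -/
private theorem irreducible_three_of_tower (W : WeierstrassCurve ℚ) [W.IsElliptic]
    (htower : ∀ n : ℕ, W.HasSurjectiveModNGaloisRep (3 ^ n : ℕ)) :
    W.HasIrreducibleModPGaloisRep 3 :=
  hasIrreducibleModPGaloisRep_of_hasSurjectiveModNGaloisRep W 3 (by simpa using htower 1)

/-- **Crux 19076 on the Kato-Tamagawa-sharp slice** (`hKato` = Kato Thm. 14.5 (3) + Prop. 14.16 (2) +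
§14.8, Tamagawa-EXACT reading, named fact): for `W/ℚ` globally minimal with the `3`-adic tower onto,
`Ш(E/ℚ)` finite, `f` the newform (crux binders), `3` additive potentially good, the period transfer
`Ω(W) = u · Ω⁺_f` (`|u|₃ = 1`), on the slice `∂⁽⁰⁾(δ̃) ≤ v₃(∏ c_ℓ)` (where Kato's bound is sharp and
`Ш(E)[3] = 0`): `∂^{(∞)}_{deep} = d ∈ ℕ` and `ord₃ #Ш(3) + d ≤ ∂⁽⁰⁾` — the crux's exact conclusion.
[cite: Kato2004Asterisque, Thm. 14.5 (3) (p. 236), Prop. 14.16 (2) (p. 244), §14.8 (p. 238)]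
[cite: Kim2022StructureSelmer, §1.5.1 (PDF p. 7)] -/
theorem deepUpper_conclusion_potGood_of_kuriharaPartial_zero_le_tamagawa_of_kato2004TamagawaExact
    (hKato : Kato2004.rankZero_padicValNat_sha_add_padicValNat_tamagawa_le_of_additive_potGood_of_imageContainsSL2) :
    ∀ (W : WeierstrassCurve ℚ) [W.IsElliptic] [W.IsGloballyMinimal],
      (∀ n : ℕ, W.HasSurjectiveModNGaloisRep (3 ^ n : ℕ)) →
      Finite W.sha →
      ∀ {N : ℕ} [NeZero N] (f : CuspForm (Gamma0 N) 2), IsNewformOf W f →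
      (∀ r : ℚ, ratPlusSymbol f r ≠ 0 → 0 ≤ padicValRat 3 (ratPlusSymbol f r)) →
      kuriharaVanishingOrder W 3 f = 0 →
      ¬ W.HasGoodReductionAtPrime 3 → ¬ W.HasMultiplicativeReductionAtPrime 3 →
      0 ≤ padicValRat 3 W.j →
      (∃ u : ℚ, ‖(u : ℚ_[3])‖ = 1 ∧ W.realPeriodRat = u * plusPeriod f) →
      kuriharaPartial W 3 f 0 ≤ ((padicValNat 3 W.tamagawaProduct : ℕ) : ℕ∞) →
        ∃ d : ℕ, kuriharaPartialDeepInfty W 3 f = d ∧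
          ((padicValNat 3 (Nat.card (AddCommGroup.primaryComponent W.sha 3)) + d : ℕ) : ℕ∞) ≤
            kuriharaPartial W 3 f 0 := by
  intro W _ _ htower hfin N _ f hf _ hord hgood hmult hpot hper hslice
  exact deepUpper_conclusion_of_add_le_of_le W 3 f hord
    (sha_add_tamagawa_le_kuriharaPartial_zero_of_kato2004TamagawaExact hKato W htower hfin f hf hord hgood
      hmult hpot hper) hslice

/-- **The Manin-free `c₃`-sharpened Kato reading in the crux's currency, local term KEPT**
(`hKato` = Kato Thm. 14.5 (3) + Prop. 14.16 (2) with the period of Prop. 14.21 / 14.22 and the local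
index `exp*_{ω_E}(H¹(ℚ₃,T)) = c₃·3^{−t}ℤ₃`, named fact): tower onto, `Ш(E/ℚ)` finite, `f` the newform,
`3` additive potentially good, `hper` ⟹ `ord₃ #Ш(E/ℚ)(3) + v₃(c₃) ≤ ∂⁽⁰⁾(δ̃)`, `c₃` the local Tamagawa
number at `3` (`= 3` exactly on the Kodaira IV / IV* rows with `3 ∣ c₃`, else a `3`-adic unit). The
landed `deepUpperAtThree_truncation_potGood_of_kato2004ManinFree` is this with `v₃(c₃)` dropped.
[cite: Kato2004Asterisque, Thm. 14.5 (3) (p. 236), Prop. 14.16 (2) (p. 244), Prop. 14.21 and 14.22 (pp. 248–249)]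
[cite: Kim2022StructureSelmer, §3.2.3 display before Thm. 3.7 (PDF p. 16), §1.5.1 (PDF p. 7)] -/
theorem sha_add_localTamagawa_le_kuriharaPartial_zero_of_kato2004ManinFree
    (hKato : Kato2004.rankZero_padicValNat_sha_le_sub_localTamagawa_of_additive_potGood_of_imageContainsSL2_maninFree) :
    ∀ (W : WeierstrassCurve ℚ) [W.IsElliptic] [W.IsGloballyMinimal],
      (∀ n : ℕ, W.HasSurjectiveModNGaloisRep (3 ^ n : ℕ)) →
      Finite W.sha →
      ∀ {N : ℕ} [NeZero N] (f : CuspForm (Gamma0 N) 2), IsNewformOf W f →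
      kuriharaVanishingOrder W 3 f = 0 →
      ¬ W.HasGoodReductionAtPrime 3 → ¬ W.HasMultiplicativeReductionAtPrime 3 →
      0 ≤ padicValRat 3 W.j →
      (∃ u : ℚ, ‖(u : ℚ_[3])‖ = 1 ∧ W.realPeriodRat = u * plusPeriod f) →
        ((padicValNat 3 (Nat.card (AddCommGroup.primaryComponent W.sha 3)) +
            padicValNat 3 ((W.baseChange ℚ_[3]).localTamagawaNumber ℤ_[3]) : ℕ) : ℕ∞) ≤
          kuriharaPartial W 3 f 0 := by
  intro W _ _ htower hfin N _ f hf _ hgood hmult hpot hper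
  by_cases h0 : ratPlusSymbol f 0 = 0
  · rw [kuriharaPartial_zero_eq_top_of_ratPlusSymbol_eq_zero W 3 f h0]
    exact le_top
  · obtain ⟨q, hq, hle⟩ := hKato W 3 (by norm_num) hgood hmult hpot
      (Kato2004.imageContainsSL2_of_forall_hasSurjectiveModNGaloisRep W 3 htower)
      (hf.entireLFunction_one_ne_zero_of_ratPlusSymbol_zero_ne_zero h0) hfin
    have hle' : ((padicValNat 3 (Nat.card (AddCommGroup.primaryComponent W.sha 3)) +
        padicValNat 3 ((W.baseChange ℚ_[3]).localTamagawaNumber ℤ_[3]) : ℕ) : ℤ) ≤ padicValRat 3 q := by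
      rw [Nat.cast_add]
      linarith
    exact natCast_le_kuriharaPartial_zero_of_le_padicValRat W 3 f (by norm_num)
      (irreducible_three_of_tower W htower) hf hper hq hle'

/-- **Crux 19076 on the slice `ord₃ δ̃₁ ≤ v₃(c₃)`** — the seat fragment's «next slice `v₃(c₃) = 1`
(Kodaira IV, IV*)» in the form in which it is a THEOREM from print: tower onto, `Ш(E/ℚ)` finite, `f`
the newform, `3` additive potentially good, `hper`, and `∂⁽⁰⁾(δ̃) ≤ v₃(c₃)` (on the IV/IV* rows with
`3 ∣ c₃`: `ord₃ δ̃₁ ≤ 1`) ⟹ the crux's exact conclusion (there `Ш(E)[3] = 0` by the Manin-free Kato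
reading). No Tamagawa-away-from-`3`, Manin or parity binder.
[cite: Kato2004Asterisque, Thm. 14.5 (3) (p. 236), Prop. 14.16 (2) (p. 244), Prop. 14.21 and 14.22 (pp. 248–249)]
[cite: Kim2022StructureSelmer, §1.5.1 (PDF p. 7)] -/
theorem deepUpper_conclusion_potGood_of_kuriharaPartial_zero_le_localTamagawa_of_kato2004ManinFree
    (hKato : Kato2004.rankZero_padicValNat_sha_le_sub_localTamagawa_of_additive_potGood_of_imageContainsSL2_maninFree) :
    ∀ (W : WeierstrassCurve ℚ) [W.IsElliptic] [W.IsGloballyMinimal],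
      (∀ n : ℕ, W.HasSurjectiveModNGaloisRep (3 ^ n : ℕ)) →
      Finite W.sha →
      ∀ {N : ℕ} [NeZero N] (f : CuspForm (Gamma0 N) 2), IsNewformOf W f →
      (∀ r : ℚ, ratPlusSymbol f r ≠ 0 → 0 ≤ padicValRat 3 (ratPlusSymbol f r)) →
      kuriharaVanishingOrder W 3 f = 0 →
      ¬ W.HasGoodReductionAtPrime 3 → ¬ W.HasMultiplicativeReductionAtPrime 3 →
      0 ≤ padicValRat 3 W.j →
      (∃ u : ℚ, ‖(u : ℚ_[3])‖ = 1 ∧ W.realPeriodRat = u * plusPeriod f) →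
      kuriharaPartial W 3 f 0 ≤
        ((padicValNat 3 ((W.baseChange ℚ_[3]).localTamagawaNumber ℤ_[3]) : ℕ) : ℕ∞) →
        ∃ d : ℕ, kuriharaPartialDeepInfty W 3 f = d ∧
          ((padicValNat 3 (Nat.card (AddCommGroup.primaryComponent W.sha 3)) + d : ℕ) : ℕ∞) ≤
            kuriharaPartial W 3 f 0 := by
  intro W _ _ htower hfin N _ f hf _ hord hgood hmult hpot hper hslice
  exact deepUpper_conclusion_of_add_le_of_le W 3 f hord
    (sha_add_localTamagawa_le_kuriharaPartial_zero_of_kato2004ManinFree hKato W htower hfin f hf hord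
      hgood hmult hpot hper) hslice

/-! ### §3 The unit-`δ̃₁` slice on the WHOLE additive locus, incl. potentially multiplicative rows -/

/-- **Crux 19076 on the unit-`δ̃₁` slice of the additive locus, potentially MULTIPLICATIVE rows
included** (`hKN` = Kim–Nakamura 2020 Thm. 1.7 / Rem. 1.8 (1), named fact): for `W/ℚ` globally minimal
with the `3`-adic tower onto, `Ш(E/ℚ)` finite, `f` the newform (crux binders), `3` ADDITIVE (potentially
good OR potentially multiplicative), `(E, 3)` not exceptional, `3 ∤ ∏ c_ℓ`, `3 ∤ ℓ ∓ 1` at the split /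
non-split multiplicative primes `ℓ`, the period transfer, a parametrisation datum `D` with `3 ∤ c_D`,
and `∂⁽⁰⁾(δ̃) = 0` (`ord₃ δ̃₁ = 0`, i.e. `L(E,1)/Ω⁺_f` a `3`-adic unit): the crux's exact conclusion
(with `d = 0` and `Ш(E)[3] = 0`). First piece of the birth stub `stub_upper_potMult` (`ord₃ j < 0`).
[cite: KimNakamura2020, Thm. 1.7 and Rem. 1.8 (1) (arXiv p. 4), Thm. 4.2 (2) and (4.3) (arXiv pp. 9–10)]
[cite: Kim2022StructureSelmer, §1.5.1 (PDF p. 7)] -/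
theorem deepUpper_conclusion_additive_unitLevelOne_of_kimNakamura2020
    (hKN : KimNakamura2020.rankZero_padicValNat_sha_le_of_maninConstant) :
    ∀ (W : WeierstrassCurve ℚ) [W.IsElliptic] [W.IsGloballyMinimal],
      (∀ n : ℕ, W.HasSurjectiveModNGaloisRep (3 ^ n : ℕ)) →
      Finite W.sha →
      ∀ {N : ℕ} [NeZero N] (f : CuspForm (Gamma0 N) 2), IsNewformOf W f →
      (∀ r : ℚ, ratPlusSymbol f r ≠ 0 → 0 ≤ padicValRat 3 (ratPlusSymbol f r)) →
      kuriharaVanishingOrder W 3 f = 0 →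
      ¬ W.HasGoodReductionAtPrime 3 → ¬ W.HasMultiplicativeReductionAtPrime 3 →
      KimNakamura2020.NonExceptional W 3 →
      ¬ 3 ∣ W.tamagawaProduct →
      (∀ (ℓ : ℕ) [Fact ℓ.Prime], W.HasMultiplicativeReductionAtPrime ℓ →
        (W.HasSplitMultiplicativeReductionAtPrime ℓ → ¬ 3 ∣ ℓ - 1) ∧
          (¬ W.HasSplitMultiplicativeReductionAtPrime ℓ → ¬ 3 ∣ ℓ + 1)) →
      (∃ u : ℚ, ‖(u : ℚ_[3])‖ = 1 ∧ W.realPeriodRat = u * plusPeriod f) →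
      ∀ {N' : ℕ} [NeZero N'] (D : ModularParametrizationData W N'), ¬ (3 : ℤ) ∣ D.maninConstant →
      kuriharaPartial W 3 f 0 = 0 →
        ∃ d : ℕ, kuriharaPartialDeepInfty W 3 f = d ∧
          ((padicValNat 3 (Nat.card (AddCommGroup.primaryComponent W.sha 3)) + d : ℕ) : ℕ∞) ≤
            kuriharaPartial W 3 f 0 := by
  intro W _ _ htower hfin N _ f hf hint hord hgood hmult hNE htam hmul hper N' _ D hc hunit
  refine deepUpper_conclusion_of_add_le_of_le W 3 f hord (e := 0) ?_ (by rw [hunit]; exact le_rfl)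
  rw [add_zero]
  exact deepUpperAtThree_truncation_additive_of_kimNakamura2020 hKN W htower hfin f hf hint hord hgood hmult
    hNE htam hmul hper D hc

/-- **The same, on the genuinely potentially-multiplicative rows** (`ord₃ j < 0`, the binder of the
birth stub `stub_upper_potMult`): `ord₃ j < 0` at an additive `3` is the potentially multiplicative
case; the statement is the previous one restricted (the sign of `ord₃ j` is not used by Kim–Nakamura's
bound, which covers both additive types). [cite: KimNakamura2020, Thm. 1.7 and Rem. 1.8 (1) (arXiv p. 4)] -/
theorem deepUpper_conclusion_potMult_unitLevelOne_of_kimNakamura2020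
    (hKN : KimNakamura2020.rankZero_padicValNat_sha_le_of_maninConstant) :
    ∀ (W : WeierstrassCurve ℚ) [W.IsElliptic] [W.IsGloballyMinimal],
      (∀ n : ℕ, W.HasSurjectiveModNGaloisRep (3 ^ n : ℕ)) →
      Finite W.sha →
      ∀ {N : ℕ} [NeZero N] (f : CuspForm (Gamma0 N) 2), IsNewformOf W f →
      (∀ r : ℚ, ratPlusSymbol f r ≠ 0 → 0 ≤ padicValRat 3 (ratPlusSymbol f r)) →
      kuriharaVanishingOrder W 3 f = 0 →
      padicValRat 3 W.j < 0 →
      ¬ W.HasGoodReductionAtPrime 3 → ¬ W.HasMultiplicativeReductionAtPrime 3 →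
      KimNakamura2020.NonExceptional W 3 →
      ¬ 3 ∣ W.tamagawaProduct →
      (∀ (ℓ : ℕ) [Fact ℓ.Prime], W.HasMultiplicativeReductionAtPrime ℓ →
        (W.HasSplitMultiplicativeReductionAtPrime ℓ → ¬ 3 ∣ ℓ - 1) ∧
          (¬ W.HasSplitMultiplicativeReductionAtPrime ℓ → ¬ 3 ∣ ℓ + 1)) →
      (∃ u : ℚ, ‖(u : ℚ_[3])‖ = 1 ∧ W.realPeriodRat = u * plusPeriod f) →
      ∀ {N' : ℕ} [NeZero N'] (D : ModularParametrizationData W N'), ¬ (3 : ℤ) ∣ D.maninConstant →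
      kuriharaPartial W 3 f 0 = 0 →
        ∃ d : ℕ, kuriharaPartialDeepInfty W 3 f = d ∧
          ((padicValNat 3 (Nat.card (AddCommGroup.primaryComponent W.sha 3)) + d : ℕ) : ℕ∞) ≤
            kuriharaPartial W 3 f 0 := by
  intro W _ _ htower hfin N _ f hf hint hord _ hgood hmult hNE htam hmul hper N' _ D hc hunit
  exact deepUpper_conclusion_additive_unitLevelOne_of_kimNakamura2020 hKN W htower hfin f hf hint hord
    hgood hmult hNE htam hmul hper D hc hunit

end Summit.BirchSwinnertonDyer.BirchSwinnertonDyer.Theorems.KimAtThreeDeepUpperShaTrivialRungs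

end
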